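import Mathlib
import Summits.Ventures.PercRepro2.ZMeanProof
import Summits.Ventures.PercRepro2.PendantRoot
import Summits.Ventures.PercRepro2.PocketTransport
import Summits.Ventures.PercRepro2.StarGlue
import Summits.Ventures.PercRepro2.StarOProb

/-!
# The two-coin star at `a₃` with ends `o` and `b` (class `{o, b}`): glue and outcomes
(blind cell PercRepro2, night-1 g10; NIGHT1-G10.md §1)

`a₃` carries exactly the two edges `f₁ = {a₃, o}` (coin `r`) and `f₂ = {a₃, b}` (coin `s`).
On an outcome with at most one coin open `a₃` is isolated or pendant, so the connections among the
other vertices are those of the star-closed configuration; with both coins open `o` and `b` are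
glued through `a₃`.  The outcome calculus (`outc₂`, `prob_inter_outc₂`, `prob_eq_sum_outc₂`) is the
two-coin copy of `StarO`'s.
-/

namespace Summit.Ventures.PercRepro2

open StarGlue PendantRoot

namespace StarOB

variable {V : Type*} {E : Type*}

variable {ends : E → Sym2 V} {f₁ f₂ : E} {a₃ o b : V}

/-- A star edge at `a₃`, by `hstar`. -/
lemma star_edge (hstar : ∀ e, a₃ ∈ ends e → e = f₁ ∨ e = f₂) {e : E} {y : V}
    (h : ends e = s(a₃, y)) : e = f₁ ∨ e = f₂ :=
  hstar e (by rw [h]; exact Sym2.mem_mk_left _ _)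

/-- The other end of a star edge whose ends are `s(a₃, m)`. -/
lemma end_eq_of_ends_eq {m y : V} (hy : a₃ ≠ y) (h : s(a₃, y) = s(a₃, m)) : m = y := by
  rcases Sym2.eq_iff.1 h with ⟨_, h'⟩ | ⟨h', h''⟩
  · exact h'.symm
  · exact absurd h''.symm hy

/-- **The open neighbours of `a₃`** on the two-coin star. -/
theorem openAdj_a3_iff (hf₁ : ends f₁ = s(a₃, o)) (hf₂ : ends f₂ = s(a₃, b))
    (hstar : ∀ e, a₃ ∈ ends e → e = f₁ ∨ e = f₂) (h3o : a₃ ≠ o) (h3b : a₃ ≠ b) {ω : Config E}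
    {m : V} : OpenAdj ends ω a₃ m ↔ (ω f₁ = true ∧ m = o) ∨ (ω f₂ = true ∧ m = b) := by
  constructor
  · rintro ⟨e, he, hends⟩
    rcases star_edge hstar hends with rfl | rfl
    · exact Or.inl ⟨he, end_eq_of_ends_eq h3o (hf₁.symm.trans hends)⟩
    · exact Or.inr ⟨he, end_eq_of_ends_eq h3b (hf₂.symm.trans hends)⟩
  · rintro (⟨he, rfl⟩ | ⟨he, rfl⟩)
    · exact ⟨f₁, he, hf₁⟩
    · exact ⟨f₂, he, hf₂⟩

/-- Connectivity is symmetric (as an `iff`, for rewriting). -/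
lemma conn_comm (ω : Config E) (x y : V) : Conn ends ω x y ↔ Conn ends ω y x :=
  ⟨conn_symm, conn_symm⟩

/-- With the `o`-coin open, `a₃ ↔ o`. -/
theorem conn_a3_o_of_f1 (hf₁ : ends f₁ = s(a₃, o)) {ω : Config E} (h1 : ω f₁ = true) :
    Conn ends ω a₃ o :=
  conn_of_openAdj ⟨f₁, h1, hf₁⟩

/-- With the `b`-coin open, `a₃ ↔ b`. -/
theorem conn_a3_b_of_f2 (hf₂ : ends f₂ = s(a₃, b)) {ω : Config E} (h2 : ω f₂ = true) :
    Conn ends ω a₃ b :=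
  conn_of_openAdj ⟨f₂, h2, hf₂⟩

section Outcomes

variable [DecidablePred (· ∈ (touches ends {a₃})ᶜ)]

/-- At most one coin open: connections among vertices other than `a₃` are star-closed ones. -/
theorem conn_iff_single (hf₁ : ends f₁ = s(a₃, o)) (hf₂ : ends f₂ = s(a₃, b))
    (hstar : ∀ e, a₃ ∈ ends e → e = f₁ ∨ e = f₂) (h3o : a₃ ≠ o) (h3b : a₃ ≠ b) {ω : Config E}
    (h12 : ¬ (ω f₁ = true ∧ ω f₂ = true)) {x y : V} (hx : x ≠ a₃) (hy : y ≠ a₃) :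
    Conn ends ω x y ↔ Conn ends (closeStar ends a₃ ω) x y := by
  rw [conn_iff_glue hx hy]
  constructor
  · rintro (h | ⟨⟨m, hm, hxm⟩, ⟨m', hm', hmy⟩⟩)
    · exact h
    · rw [openAdj_a3_iff hf₁ hf₂ hstar h3o h3b] at hm hm'
      have hmm : m = m' := by
        rcases hm with ⟨h1, rfl⟩ | ⟨h2, rfl⟩ <;> rcases hm' with ⟨h1', rfl⟩ | ⟨h2', rfl⟩
        · rfl
        · exact absurd ⟨h1, h2'⟩ h12
        · exact absurd ⟨h1', h2⟩ h12
        · rfl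
      subst hmm
      exact conn_trans hxm hmy
  · exact fun h => Or.inl h

/-- Both coins open: `o` and `b` are glued through `a₃`. -/
theorem conn_iff_glue_ob (hf₁ : ends f₁ = s(a₃, o)) (hf₂ : ends f₂ = s(a₃, b))
    (hstar : ∀ e, a₃ ∈ ends e → e = f₁ ∨ e = f₂) (h3o : a₃ ≠ o) (h3b : a₃ ≠ b) {ω : Config E}
    (h1 : ω f₁ = true) (h2 : ω f₂ = true) {x y : V} (hx : x ≠ a₃) (hy : y ≠ a₃) :
    Conn ends ω x y ↔ Conn ends (closeStar ends a₃ ω) x y ∨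
      (Conn ends (closeStar ends a₃ ω) x o ∧ Conn ends (closeStar ends a₃ ω) b y) ∨
      (Conn ends (closeStar ends a₃ ω) x b ∧ Conn ends (closeStar ends a₃ ω) o y) := by
  rw [conn_iff_glue hx hy]
  have hnb : ∀ m, OpenAdj ends ω a₃ m ↔ m = o ∨ m = b := by
    intro m
    rw [openAdj_a3_iff hf₁ hf₂ hstar h3o h3b]
    constructor
    · rintro (⟨_, rfl⟩ | ⟨_, rfl⟩)
      · exact Or.inl rfl
      · exact Or.inr rfl
    · rintro (rfl | rfl)
      · exact Or.inl ⟨h1, rfl⟩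
      · exact Or.inr ⟨h2, rfl⟩
  constructor
  · rintro (h | ⟨⟨m, hm, hxm⟩, ⟨m', hm', hmy⟩⟩)
    · exact Or.inl h
    · rw [hnb] at hm hm'
      rcases hm with rfl | rfl <;> rcases hm' with rfl | rfl
      · exact Or.inl (conn_trans hxm hmy)
      · exact Or.inr (Or.inl ⟨hxm, hmy⟩)
      · exact Or.inr (Or.inr ⟨hxm, hmy⟩)
      · exact Or.inl (conn_trans hxm hmy)
  · rintro (h | ⟨hxo, hby⟩ | ⟨hxb, hoy⟩)
    · exact Or.inl h
    · exact Or.inr ⟨⟨o, (hnb o).2 (Or.inl rfl), hxo⟩, ⟨b, (hnb b).2 (Or.inr rfl), hby⟩⟩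
    · exact Or.inr ⟨⟨b, (hnb b).2 (Or.inr rfl), hxb⟩, ⟨o, (hnb o).2 (Or.inl rfl), hoy⟩⟩

/-- Both coins closed: `a₃` is isolated. -/
theorem not_conn_a3_cc (hf₁ : ends f₁ = s(a₃, o)) (hf₂ : ends f₂ = s(a₃, b))
    (hstar : ∀ e, a₃ ∈ ends e → e = f₁ ∨ e = f₂) (h3o : a₃ ≠ o) (h3b : a₃ ≠ b) {ω : Config E}
    (h1 : ω f₁ = false) (h2 : ω f₂ = false) {y : V} (hy : y ≠ a₃) : ¬ Conn ends ω a₃ y := by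
  rw [conn_a3_iff_glue hy]
  rintro ⟨m, hm, _⟩
  rw [openAdj_a3_iff hf₁ hf₂ hstar h3o h3b] at hm
  rcases hm with ⟨h, _⟩ | ⟨h, _⟩
  · rw [h1] at h; exact Bool.false_ne_true h
  · rw [h2] at h; exact Bool.false_ne_true h

/-- Only the `o`-coin open: the cluster of `a₃` is the star-closed cluster of `o`. -/
theorem conn_a3_iff_f1 (hf₁ : ends f₁ = s(a₃, o)) (hf₂ : ends f₂ = s(a₃, b))
    (hstar : ∀ e, a₃ ∈ ends e → e = f₁ ∨ e = f₂) (h3o : a₃ ≠ o) (h3b : a₃ ≠ b) {ω : Config E}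
    (h1 : ω f₁ = true) (h2 : ω f₂ = false) {y : V} (hy : y ≠ a₃) :
    Conn ends ω a₃ y ↔ Conn ends (closeStar ends a₃ ω) o y := by
  rw [conn_a3_iff_glue hy]
  constructor
  · rintro ⟨m, hm, hmy⟩
    rw [openAdj_a3_iff hf₁ hf₂ hstar h3o h3b] at hm
    rcases hm with ⟨_, rfl⟩ | ⟨h, _⟩
    · exact hmy
    · rw [h2] at h; exact absurd h Bool.false_ne_true
  · intro h
    exact ⟨o, (openAdj_a3_iff hf₁ hf₂ hstar h3o h3b).2 (Or.inl ⟨h1, rfl⟩), h⟩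

/-- Only the `b`-coin open: the cluster of `a₃` is the star-closed cluster of `b`. -/
theorem conn_a3_iff_f2 (hf₁ : ends f₁ = s(a₃, o)) (hf₂ : ends f₂ = s(a₃, b))
    (hstar : ∀ e, a₃ ∈ ends e → e = f₁ ∨ e = f₂) (h3o : a₃ ≠ o) (h3b : a₃ ≠ b) {ω : Config E}
    (h1 : ω f₁ = false) (h2 : ω f₂ = true) {y : V} (hy : y ≠ a₃) :
    Conn ends ω a₃ y ↔ Conn ends (closeStar ends a₃ ω) b y := by
  rw [conn_a3_iff_glue hy]
  constructor
  · rintro ⟨m, hm, hmy⟩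
    rw [openAdj_a3_iff hf₁ hf₂ hstar h3o h3b] at hm
    rcases hm with ⟨h, _⟩ | ⟨_, rfl⟩
    · rw [h1] at h; exact absurd h Bool.false_ne_true
    · exact hmy
  · intro h
    exact ⟨b, (openAdj_a3_iff hf₁ hf₂ hstar h3o h3b).2 (Or.inr ⟨h2, rfl⟩), h⟩

/-- Both coins open: the cluster of `a₃` is the union of the star-closed clusters of `o`, `b`. -/
theorem conn_a3_iff_oo (hf₁ : ends f₁ = s(a₃, o)) (hf₂ : ends f₂ = s(a₃, b))
    (hstar : ∀ e, a₃ ∈ ends e → e = f₁ ∨ e = f₂) (h3o : a₃ ≠ o) (h3b : a₃ ≠ b) {ω : Config E}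
    (h1 : ω f₁ = true) (h2 : ω f₂ = true) {y : V} (hy : y ≠ a₃) :
    Conn ends ω a₃ y ↔
      Conn ends (closeStar ends a₃ ω) o y ∨ Conn ends (closeStar ends a₃ ω) b y := by
  rw [conn_a3_iff_glue hy]
  constructor
  · rintro ⟨m, hm, hmy⟩
    rw [openAdj_a3_iff hf₁ hf₂ hstar h3o h3b] at hm
    rcases hm with ⟨_, rfl⟩ | ⟨_, rfl⟩
    · exact Or.inl hmy
    · exact Or.inr hmy
  · rintro (h | h)
    · exact ⟨o, (openAdj_a3_iff hf₁ hf₂ hstar h3o h3b).2 (Or.inl ⟨h1, rfl⟩), h⟩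
    · exact ⟨b, (openAdj_a3_iff hf₁ hf₂ hstar h3o h3b).2 (Or.inr ⟨h2, rfl⟩), h⟩

end Outcomes

end StarOB

namespace StarOB

section Infra

variable {V : Type*} {E : Type*} [Fintype E] [DecidableEq E] [Fintype V] [DecidableEq V]
  {R : Type*} [Field R] [LinearOrder R] [IsStrictOrderedRing R]

variable (p : E → R) (ends : E → Sym2 V) (a₃ : V)

open StarO (pOut viaStar cw prob_viaStar free_viaStar prob_inter_coin free_coin_of_ne)

/-- The coin outcome `{ω f₁ = b₁, ω f₂ = b₂}` of the two-coin star. -/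
def outc₂ (f₁ f₂ : E) (b₁ b₂ : Bool) : Set (Config E) := {ω | ω f₁ = b₁ ∧ ω f₂ = b₂}

omit [Fintype E] [DecidableEq E] [Fintype V] [DecidableEq V] [LinearOrder R] [IsStrictOrderedRing R] in
/-- Membership in an outcome. -/
lemma mem_outc₂ {f₁ f₂ : E} {b₁ b₂ : Bool} {ω : Config E} :
    ω ∈ outc₂ f₁ f₂ b₁ b₂ ↔ ω f₁ = b₁ ∧ ω f₂ = b₂ := Iff.rfl

omit [Fintype E] [DecidableEq E] [Fintype V] [DecidableEq V] [LinearOrder R] [IsStrictOrderedRing R] in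
/-- A two-coin outcome as a three-coin outcome with a repeated edge. -/
lemma outc₂_eq_outc (f₁ f₂ : E) (b₁ b₂ : Bool) :
    outc₂ f₁ f₂ b₁ b₂ = StarO.outc f₂ f₂ f₁ b₂ b₂ b₁ := by
  ext ω; simp only [mem_outc₂, StarO.mem_outc]; tauto

omit [Fintype V] [DecidableEq V] [LinearOrder R] [IsStrictOrderedRing R] in
/-- **Factorisation on an outcome**: for `A` free of the two star edges,
`P(A ∩ outc₂ b) = P(A) · cw b₁ · cw b₂`. -/
lemma prob_inter_outc₂ {f₁ f₂ : E} (h12 : f₁ ≠ f₂) {A : Set (Config E)} (h1 : Free f₁ A)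
    (h2 : Free f₂ A) (b₁ b₂ : Bool) :
    prob p (A ∩ outc₂ f₁ f₂ b₁ b₂) = prob p A * cw b₁ (p f₁) * cw b₂ (p f₂) := by
  have e : A ∩ outc₂ f₁ f₂ b₁ b₂ = (A ∩ {ω | ω f₁ = b₁}) ∩ {ω | ω f₂ = b₂} := by
    ext ω; simp only [Set.mem_inter_iff, mem_outc₂, Set.mem_setOf_eq]; tauto
  rw [e, prob_inter_coin p (h2.inter (free_coin_of_ne h12.symm b₁)) b₂, prob_inter_coin p h1 b₁]

omit [Fintype V] [DecidableEq V] [LinearOrder R] [IsStrictOrderedRing R] in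
/-- **The outcomes partition the space.** -/
lemma prob_eq_sum_outc₂ (f₁ f₂ : E) (A : Set (Config E)) :
    prob p A = ∑ b₁ : Bool, ∑ b₂ : Bool, prob p (A ∩ outc₂ f₁ f₂ b₁ b₂) := by
  have h1 : ∀ (B : Set (Config E)) (f : E),
      prob p B = ∑ b : Bool, prob p (B ∩ {ω | ω f = b}) := by
    intro B f
    rw [Fintype.sum_bool]
    have := prob_inter_add_prob_inter_compl p B (openEdge f)
    rw [← this]
    have hc : {ω : Config E | ω f = false} = (openEdge f)ᶜ := by
      ext ω; simp [openEdge]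
    rw [hc]
    rfl
  rw [h1 A f₁]
  refine Finset.sum_congr rfl fun b₁ _ => ?_
  rw [h1 (A ∩ {ω | ω f₁ = b₁}) f₂]
  refine Finset.sum_congr rfl fun b₂ _ => ?_
  congr 1
  ext ω; simp only [Set.mem_inter_iff, Set.mem_setOf_eq, mem_outc₂]; tauto

omit [Fintype E] [DecidableEq E] [Fintype V] [DecidableEq V] [LinearOrder R] [IsStrictOrderedRing R] in
/-- The outcome event is determined by the two coins. -/
lemma dependsOn_outc₂ (f₁ f₂ : E) (b₁ b₂ : Bool) :
    DependsOn (· ∈ outc₂ f₁ f₂ b₁ b₂) ({f₁, f₂} : Set E) := by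
  intro ω ω' h
  show (ω f₁ = b₁ ∧ ω f₂ = b₂) = (ω' f₁ = b₁ ∧ ω' f₂ = b₂)
  rw [h f₁ (by simp), h f₂ (by simp)]

omit [Fintype E] [DecidableEq E] [Fintype V] [DecidableEq V] [LinearOrder R] [IsStrictOrderedRing R] in
/-- The two star edges are distinct when their far ends differ. -/
lemma star_edges_ne {f₁ f₂ : E} {o b : V} (hf₁ : ends f₁ = s(a₃, o)) (hf₂ : ends f₂ = s(a₃, b))
    (hob : o ≠ b) (h3o : a₃ ≠ o) : f₁ ≠ f₂ := by
  intro h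
  subst h
  rw [hf₁] at hf₂
  exact hob (end_eq_of_ends_eq h3o hf₂).symm

end Infra

end StarOB

end Summit.Ventures.PercRepro2
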